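import Summits.PneNP.PneNP.Theorems.SoloInformedLinearLadder
import Summits.PneNP.PneNP.Theorems.SoloInformedLinearLadderWlin
import HarnessLib

/-!
# The linear-time ladder, III: `PneNP ↔ ∀ k, NTIME(n) ⊄ DTIME(nᵏ)` and `PneNP ↔ Wlin ∉ P`

Soloist file (`solo-PneNP-informed`, summit-directed charter; landing prefix `SoloInformed`).
Combines part I (`SoloInformedLinearLadder.lean`: `PneNP → ∀ k, NTIME(n) ⊄ DTIME(nᵏ)`, downward
translation by linear padding) with part II (`SoloInformedLinearLadderWlin.lean`: the explicit `NP`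
language `Wlin` with `Wlin ∈ DTIME(nᵏ) → NTIME(n) ⊆ DTIME(nᵏ⁺¹)`, by linear-time reductions):

* `soloInformed_pneNP_iff_forall_not_NTIME_id_subset_DTIME_pow` —
  **`PneNP ↔ ∀ k, ¬ (NTIME(n) ⊆ DTIME(nᵏ))`** (and the same with `k ≥ 1`): the summit is EXACTLY the
  statement that every rung of the linear-time ladder holds, of which the rung `k = 1`
  (Paul–Pippenger–Szemerédi–Trotter 1983, for multitape machines) is the only one that is a theorem;
* `soloInformed_pneNP_iff_Wlin_not_mem_P` — **`PneNP ↔ Wlin ∉ P`**: one explicit language decides it;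
  `soloInformed_pneNP_iff_forall_not_timeDecidable_Wlin` — the same unfolded to machines:
  `PneNP ↔ ∀ k c, ¬ TimeDecidable id Wlin (c·nᵏ + c)`.

Nothing here is progress toward `P ≠ NP`; it is a kernel-checked SHARPENING OF THE SUMMIT STATEMENT.
References: W. Paul, N. Pippenger, E. Szemerédi, W. Trotter, FOCS 1983, 429–438 [PaulEtAl1983];
S. Arora, B. Barak, *Computational Complexity* (2009), Thm. 1.9, §1.4.1, Thm. 2.22 (padding)
[AroraBarakCC2009]. Standard axioms only.
-/

namespace Summit.PneNP.PneNP.Theorems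

open Literature.Computability.Complexity SoloLinearLadder

/-- **The summit as the limit of the linear-time ladder**:
`PneNP ↔ ∀ k, ¬ (NTIME(n) ⊆ DTIME(nᵏ))`. The rung `k = 1` is the theorem of
Paul–Pippenger–Szemerédi–Trotter (1983); no rung `k > 1` is known. [cite: PaulEtAl1983, main theorem]
[cite: AroraBarakCC2009, §2.6.2 Thm. 2.22 (padding)] -/
theorem soloInformed_pneNP_iff_forall_not_NTIME_id_subset_DTIME_pow :
    PneNP ↔ ∀ k : ℕ, ¬ (NTIME (fun n => n) ⊆ DTIME (fun n => n ^ k)) := by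
  refine ⟨soloInformed_not_NTIME_id_subset_DTIME_pow_of_pneNP, fun h => ?_⟩
  by_contra hne
  obtain ⟨k, -, hk⟩ := soloInformed_exists_NTIME_id_subset_DTIME_pow_of_not_pneNP hne
  exact h k hk

/-- The same with the exponent restricted to `k ≥ 1` (the rungs of the ladder proper).
[cite: PaulEtAl1983, main theorem] [cite: AroraBarakCC2009, §2.6.2 Thm. 2.22 (padding)] -/
theorem soloInformed_pneNP_iff_forall_pos_not_NTIME_id_subset_DTIME_pow :
    PneNP ↔ ∀ k : ℕ, 1 ≤ k → ¬ (NTIME (fun n => n) ⊆ DTIME (fun n => n ^ k)) := by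
  refine ⟨fun h k _ => soloInformed_not_NTIME_id_subset_DTIME_pow_of_pneNP h k, fun h => ?_⟩
  by_contra hne
  obtain ⟨k, hk1, hk⟩ := soloInformed_exists_NTIME_id_subset_DTIME_pow_of_not_pneNP hne
  exact h k hk1 hk

/-- **`PneNP ↔ Wlin ∉ P`** for the one explicit language `Wlin` (bounded universal acceptance at
linear scale): `Wlin ∈ NP`, and `Wlin ∈ P` would put `NTIME(n)` inside some `DTIME(nᵏ)` and hence
`NP` inside `P`. [cite: AroraBarakCC2009, Thm. 1.9 and §1.4.1] -/
theorem soloInformed_pneNP_iff_Wlin_not_mem_P : PneNP ↔ Wlin ∉ Classes.P := by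
  constructor
  · intro h hWP
    simp only [Classes.P, Set.mem_iUnion] at hWP
    obtain ⟨k, hk⟩ := hWP
    exact soloInformed_not_NTIME_id_subset_DTIME_pow_of_pneNP h (k + 1)
      (soloInformed_NTIME_id_subset_DTIME_pow_succ_of_Wlin_mem_DTIME hk)
  · intro h
    exact soloInformed_pneNP_iff_exists_not_mem.2 ⟨Wlin, Wlin_mem_NP, h⟩

/-- Machine-level unfolding of `PneNP ↔ Wlin ∉ P`: **`P ≠ NP` iff for every exponent `k` and every
constant `c` NO single multi-stack (`TM2`) machine decides the one explicit language `Wlin` within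
`c·nᵏ + c` steps on all inputs of length `n`** (`TimeDecidable id Wlin t = ∃ M, DecidesInTime id Wlin _ M`).
This is the `∃∀` summit with the existential witness fixed. [folklore] -/
theorem soloInformed_pneNP_iff_forall_not_timeDecidable_Wlin :
    PneNP ↔ ∀ k c : ℕ, ¬ TimeDecidable (id : List Bool → List Bool) Wlin (fun n => c * n ^ k + c) := by
  rw [soloInformed_pneNP_iff_Wlin_not_mem_P]
  simp only [Classes.P, Set.mem_iUnion, DTIME, TimeClass, Set.mem_setOf_eq, not_exists]

end Summit.PneNP.PneNP.Theorems
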